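import Mathlib

/-!
# DROWS-SOUND, piece (s1) interface: a finite sum regrouped through a certified shell histogram

decomp-a2c hand-2 g46 — structural share for `AperiodicFrustratedLawGap` (stmt-27623), class-D rows (critic r1757 (C)(b) «DROWS-SOUND»).
The K readings `…DRowsBccSound.drows_bcc_sound` / `…A15Sound` / `…C15Sound` bound the BOOKED window sum
`Σ_{(D,m) ∈ H, inside D} m·F(D)` of a certified histogram `H : List (ℕ × ℕ)`; the analytic assembly `…DRowsAssembly` consumes the TRUE window
sum `Σ_{z ∈ W} F(key z)` over the finite set `W` of window atoms (`key z` = the integer squared length of the template vector, `F(D) = φ(s²·D/den)`).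
Piece (s1) is the statement that the two agree, i.e. that `H` records the true shell multiplicities.  This file reduces (s1) to three finite,
kernel-decidable facts about `W`, `key` and `H` — COVER (every window atom's key is a booked shell inside the cut), FIBRES (each booked shell inside
the cut has exactly the booked number of atoms) and NODUP (no shell is booked twice):

  `sum_key_eq_histogram : Σ_{z ∈ W} F (key z) = (H.map fun (D,m) => if inside D then m·F D else 0).sum`.

Pure finite combinatorics (`Finset.sum_filter_add_sum_filter_not` and an induction on `H`); DEF-FREE; Mathlib only.
-/

namespace Summit.AtomisticToContinuum.Crystallization.Theorems.FrustratedLawDichotomyDRowsRegroup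

open scoped BigOperators

/-- on the fibre of a key value the summand is constant: `Σ_{z ∈ W, key z = D} F (key z) = #fibre · F D`. [folklore] -/
theorem sum_filter_key_eq {α : Type*} (key : α → ℕ) (F : ℕ → ℝ) (W : Finset α) (D : ℕ) :
    ∑ z ∈ W.filter (fun z => key z = D), F (key z) = ((W.filter fun z => key z = D).card : ℝ) * F D := by
  rw [Finset.sum_congr rfl fun z hz => by rw [(Finset.mem_filter.mp hz).2], Finset.sum_const, nsmul_eq_mul]

/-- ★ **REGROUPING THROUGH A HISTOGRAM.**  If every `z ∈ W` has its key booked by some entry `(D, m) ∈ H` with `inside D` (COVER), every entry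
`(D, m) ∈ H` with `inside D` has exactly `m` atoms of key `D` in `W` (FIBRES), and the keys of `H` are pairwise distinct (NODUP), then
`Σ_{z ∈ W} F (key z) = Σ_{(D,m) ∈ H, inside D} m·F D`. [folklore] -/
theorem sum_key_eq_histogram {α : Type*} (key : α → ℕ) (F : ℕ → ℝ) (P : ℕ → Prop) [DecidablePred P] :
    ∀ (H : List (ℕ × ℕ)), (H.map Prod.fst).Nodup → ∀ (W : Finset α),
      (∀ z ∈ W, ∃ Dm ∈ H, P Dm.1 ∧ key z = Dm.1) →
      (∀ Dm ∈ H, P Dm.1 → (W.filter fun z => key z = Dm.1).card = Dm.2) →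
      ∑ z ∈ W, F (key z) = (H.map fun Dm : ℕ × ℕ => if P Dm.1 then (Dm.2 : ℝ) * F Dm.1 else 0).sum := by
  intro H
  induction H with
  | nil =>
    intro _ W hcov _
    have hW : W = ∅ := Finset.eq_empty_of_forall_notMem fun z hz => by
      obtain ⟨Dm, hDm, -⟩ := hcov z hz
      simp at hDm
    simp [hW]
  | cons Dm rest ih =>
    intro hnd W hcov hfib
    obtain ⟨D, m⟩ := Dm
    rw [List.map_cons, List.nodup_cons] at hnd
    obtain ⟨hDnot, hrest⟩ := hnd
    have hDnot' : ∀ Dm ∈ rest, Dm.1 ≠ D := fun Dm hDm h => hDnot (List.mem_map.mpr ⟨Dm, hDm, h⟩)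
    rw [List.map_cons, List.sum_cons, ← Finset.sum_filter_add_sum_filter_not W (fun z => key z = D), sum_filter_key_eq]
    -- the head shell
    have hhead : ((W.filter fun z => key z = D).card : ℝ) * F D = if P D then (m : ℝ) * F D else 0 := by
      by_cases hP : P D
      · rw [if_pos hP, hfib (D, m) List.mem_cons_self hP]
      · rw [if_neg hP]
        have hempty : (W.filter fun z => key z = D) = ∅ := by
          refine Finset.eq_empty_of_forall_notMem fun z hz => ?_
          obtain ⟨hzW, hzD⟩ := Finset.mem_filter.mp hz
          obtain ⟨Dm', hDm', hP', hkey⟩ := hcov z hzW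
          rcases List.mem_cons.mp hDm' with h | h
          · subst h; exact hP hP'
          · exact hDnot' Dm' h (hkey ▸ hzD ▸ rfl)
        rw [hempty]; simp
    -- the other shells, by induction on the window restricted away from key `D`
    have htail : ∑ z ∈ W.filter (fun z => ¬ key z = D), F (key z) =
        (rest.map fun Dm : ℕ × ℕ => if P Dm.1 then (Dm.2 : ℝ) * F Dm.1 else 0).sum := by
      refine ih hrest _ (fun z hz => ?_) (fun Dm' hDm' hP' => ?_)
      · obtain ⟨hzW, hzD⟩ := Finset.mem_filter.mp hz
        obtain ⟨Dm', hDm', hP', hkey⟩ := hcov z hzW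
        rcases List.mem_cons.mp hDm' with h | h
        · exact absurd (hkey.trans (by rw [h])) hzD
        · exact ⟨Dm', h, hP', hkey⟩
      · rw [← hfib Dm' (List.mem_cons_of_mem _ hDm') hP', Finset.filter_filter]
        congr 1
        refine Finset.filter_congr fun z _ => ⟨fun h => h.2, fun h => ⟨?_, h⟩⟩
        rw [h]; exact hDnot' Dm' hDm'
    rw [hhead, htail]

end Summit.AtomisticToContinuum.Crystallization.Theorems.FrustratedLawDichotomyDRowsRegroup
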